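import Summits.RiemannHypothesis.RiemannHypothesis.Theorems.PfPersistenceF1BLExt
import HarnessLib

/-!
# PF-persistence FAKE SEAT 1, KERNEL 9: Gaussian-window domination — the measure-theoretic core of
# SUPERSET / FINITE-DELETION RIGIDITY for ζ-dressed g-prime systems (FAKES §1.16)

Framing (page 1 of every `pub-rhpf` file): **mechanism/rigidity campaign; no RH claims.**  Nothing in
this file asserts or assumes RH; no negativity of a control family is asserted.

Informal side (FAKES §1.16, THEOREM-informal, UNCONDITIONAL): write the prime-side perturbation of a
ζ-dressed g-prime system `P` as `r = m_P − m_ℙ = r⁺ − r⁻` (Jordan).  Weil positivity on compactly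
supported tests gives, for every Gaussian window `e^{-δ²u²/2}` (LEMMA GW),
`∫ e^{-δ²u²/2} dr⁺ ≤ ∫ e^{-δ²u²/2} dr⁻ + ε(δ)` with a ZEROS'-SIDE BUDGET
`ε(δ) = √(2π) η̃(δ)/δ → 0` as `δ → 0⁺` (`η̃(δ) = Σ_ρ e^{-γ_ρ²/2δ²} ≤ 10⁻⁴³` for `δ ≤ 1`: the first zero
sits at `|γ| = 14.13`).  This file proves the LIMITING STEP exactly as used there:

* `measure_univ_le_of_windowMass_le` — if the windowed masses of a measure `ρ` along `δ = 1/(n+1)` are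
  `≤ M + εₙ` with `εₙ → 0`, then `ρ(ℝ) ≤ M` (monotone convergence: the windows increase to `1`);
* `measure_eq_zero_of_windowMass_le` — the case `M = 0`: `ρ = 0` (core of THEOREM F1-SUP⁺, SUPERSET
  RIGIDITY: a system containing every prime power with at least its ζ-weight and Weil-positive adds nothing);
* `windowMass_le_of_gap` — the ZEROS'-SIDE BUDGET: a measure with no mass on `(-γ, γ)` pairs with the
  spectral Gaussian `e^{-κ²t²/2}` (`κ = 1/δ ≥ 1`) to at most `e^{-κ²γ²/4}` times a fixed pairing;
* `measure_univ_le_of_window_domination` — windowed domination `W_δ(ρ⁺) ≤ W_δ(ρ⁻) + εₙ` forces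
  `ρ⁺(ℝ) ≤ ρ⁻(ℝ)` (core of the RH-case of THEOREM F1-SUP, FINITE-DELETION RIGIDITY: finitely much deleted
  ⇒ finitely much added, whence F1-A′ applies).

The g-prime-level statements are recorded as typed `Prop`s (`SupersetRigidity`, `ThinningRigidity`,
`FiniteDeletionRigidity`; statement only, labels in the docstrings) together with the trivial links to
`BeurlingRigidity`.  Labels: core PROVED-Lean (this file); reductions PROVED-informal (FAKES §1.16).
-/

set_option linter.dupNamespace false

noncomputable section

open MeasureTheory Set Filter
open scoped ENNReal Topology

namespace Summit.RiemannHypothesis.RiemannHypothesis.Theorems.PfPersistence.Fake1.SupersetRigidity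

open Summit.RiemannHypothesis.RiemannHypothesis.Theorems.PfPersistenceBarrier
open Summit.RiemannHypothesis.RiemannHypothesis.Theorems.PfPersistenceBarrier.ExplicitDatum
open Summit.RiemannHypothesis.RiemannHypothesis.Theorems.PfPersistence.Fake1
open Summit.RiemannHypothesis.RiemannHypothesis.Theorems.PfPersistence.Fake1.BLExt

/-! ## §1 Gaussian windows -/

/-- The Gaussian window weight `e^{-δ²u²/2}` as an extended non-negative real. [folklore] -/
def gaussWindow (δ u : ℝ) : ℝ≥0∞ := ENNReal.ofReal (Real.exp (-(δ ^ 2 * u ^ 2) / 2))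

/-- The window sequence `δₙ = 1/(n+1) → 0⁺`. [folklore] -/
def δseq (n : ℕ) : ℝ := 1 / ((n : ℝ) + 1)

/-- The window parameters are positive. [folklore] -/
theorem δseq_pos (n : ℕ) : 0 < δseq n := by
  unfold δseq; positivity

/-- The window parameters decrease. [folklore] -/
theorem δseq_antitone : Antitone δseq := by
  intro n m hnm
  unfold δseq
  have hn : (0 : ℝ) < (n : ℝ) + 1 := by positivity
  have hm : (n : ℝ) + 1 ≤ (m : ℝ) + 1 := by exact_mod_cast Nat.succ_le_succ hnm
  exact one_div_le_one_div_of_le hn hm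

/-- The window parameters tend to `0`. [folklore] -/
theorem tendsto_δseq : Tendsto δseq atTop (𝓝 0) :=
  tendsto_one_div_add_atTop_nhds_zero_nat

/-- Measurability of the window in `u`. [folklore] -/
theorem measurable_gaussWindow (δ : ℝ) : Measurable (gaussWindow δ) := by
  unfold gaussWindow
  exact (by fun_prop : Measurable fun u : ℝ => Real.exp (-(δ ^ 2 * u ^ 2) / 2)).ennreal_ofReal

/-- Windows are bounded by `1`. [folklore] -/
theorem gaussWindow_le_one (δ u : ℝ) : gaussWindow δ u ≤ 1 := by
  unfold gaussWindow
  rw [← ENNReal.ofReal_one]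
  apply ENNReal.ofReal_le_ofReal
  rw [Real.exp_le_one_iff]
  have : 0 ≤ δ ^ 2 * u ^ 2 := by positivity
  linarith

/-- Windows widen as `δ` decreases (for `0 ≤ δ`). [folklore] -/
theorem gaussWindow_mono_of_le {δ₁ δ₂ : ℝ} (h0 : 0 ≤ δ₁) (h : δ₁ ≤ δ₂) (u : ℝ) :
    gaussWindow δ₂ u ≤ gaussWindow δ₁ u := by
  unfold gaussWindow
  apply ENNReal.ofReal_le_ofReal
  apply Real.exp_le_exp.2
  have : δ₁ ^ 2 * u ^ 2 ≤ δ₂ ^ 2 * u ^ 2 := by gcongr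
  linarith

/-- Along `δₙ = 1/(n+1)` the windows increase with `n`. [folklore] -/
theorem monotone_gaussWindow_δseq (u : ℝ) : Monotone fun n : ℕ => gaussWindow (δseq n) u :=
  fun _ m hnm => gaussWindow_mono_of_le (δseq_pos m).le (δseq_antitone hnm) u

/-- Along `δₙ = 1/(n+1)` the windows tend to `1`. [folklore] -/
theorem tendsto_gaussWindow_δseq (u : ℝ) :
    Tendsto (fun n : ℕ => gaussWindow (δseq n) u) atTop (𝓝 1) := by
  have hc : Continuous fun δ : ℝ => gaussWindow δ u := by
    unfold gaussWindow
    exact ENNReal.continuous_ofReal.comp (by fun_prop)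
  have h := (hc.tendsto 0).comp tendsto_δseq
  have h0 : gaussWindow 0 u = 1 := by simp [gaussWindow]
  rw [h0] at h
  exact h

/-- Along `δₙ = 1/(n+1)` the supremum of the windows is `1`. [folklore] -/
theorem iSup_gaussWindow_δseq (u : ℝ) : (⨆ n : ℕ, gaussWindow (δseq n) u) = 1 :=
  tendsto_nhds_unique (tendsto_atTop_iSup (monotone_gaussWindow_δseq u))
    (tendsto_gaussWindow_δseq u)

/-! ## §2 Windowed masses and the monotone-convergence step -/

/-- The Gaussian-windowed mass `W_δ(ρ) = ∫ e^{-δ²u²/2} dρ(u)` of a measure on `ℝ`. [folklore] -/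
def windowMass (ρ : Measure ℝ) (δ : ℝ) : ℝ≥0∞ := ∫⁻ u, gaussWindow δ u ∂ρ

/-- A windowed mass never exceeds the total mass. [folklore] -/
theorem windowMass_le_univ (ρ : Measure ℝ) (δ : ℝ) : windowMass ρ δ ≤ ρ univ := by
  unfold windowMass
  calc ∫⁻ u, gaussWindow δ u ∂ρ ≤ ∫⁻ _u, 1 ∂ρ := lintegral_mono fun u => gaussWindow_le_one δ u
    _ = ρ univ := by rw [lintegral_one]

/-- Windowed masses increase along `δₙ = 1/(n+1)`. [folklore] -/
theorem monotone_windowMass_δseq (ρ : Measure ℝ) : Monotone fun n : ℕ => windowMass ρ (δseq n) :=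
  fun _n _m hnm => lintegral_mono fun u => monotone_gaussWindow_δseq u hnm

/-- MONOTONE CONVERGENCE: along `δₙ = 1/(n+1)` the windowed masses increase to the total mass. [folklore] -/
theorem iSup_windowMass_δseq (ρ : Measure ℝ) : (⨆ n : ℕ, windowMass ρ (δseq n)) = ρ univ := by
  unfold windowMass
  rw [← lintegral_iSup (fun n => measurable_gaussWindow (δseq n))
    (fun _ _ hnm u => monotone_gaussWindow_δseq u hnm)]
  simp_rw [iSup_gaussWindow_δseq]
  rw [lintegral_one]

/-- **CORE (limit step of LEMMA GW).**  If the windowed masses of `ρ` along `δₙ → 0⁺` are bounded by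
`M + εₙ` with a budget `εₙ → 0`, then the total mass of `ρ` is at most `M`. [folklore] -/
theorem measure_univ_le_of_windowMass_le {ρ : Measure ℝ} {M : ℝ≥0∞} {ε : ℕ → ℝ≥0∞}
    (hε : Tendsto ε atTop (𝓝 0)) (h : ∀ n : ℕ, windowMass ρ (δseq n) ≤ M + ε n) :
    ρ univ ≤ M := by
  rw [← iSup_windowMass_δseq ρ]
  refine iSup_le fun n => ?_
  have hlim : Tendsto (fun m : ℕ => M + ε m) atTop (𝓝 M) := by
    simpa using (tendsto_const_nhds (x := M)).add hε
  refine ge_of_tendsto hlim ?_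
  filter_upwards [Filter.eventually_ge_atTop n] with m hm
  exact (monotone_windowMass_δseq ρ hm).trans (h m)

/-- **CORE OF THEOREM F1-SUP⁺ (SUPERSET RIGIDITY).**  If the windowed masses of `ρ` are bounded by a
vanishing budget alone (`M = 0`: nothing deleted), then `ρ = 0` (nothing added). [folklore] -/
theorem measure_eq_zero_of_windowMass_le {ρ : Measure ℝ} {ε : ℕ → ℝ≥0∞}
    (hε : Tendsto ε atTop (𝓝 0)) (h : ∀ n : ℕ, windowMass ρ (δseq n) ≤ ε n) : ρ = 0 := by
  have h0 : ρ univ ≤ 0 :=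
    measure_univ_le_of_windowMass_le (M := 0) hε (fun n => by simpa using h n)
  exact Measure.measure_univ_eq_zero.mp (le_antisymm h0 bot_le)

/-- **CORE OF THE RH-CASE OF THEOREM F1-SUP (FINITE-DELETION RIGIDITY).**  Window-by-window domination
of `ρ⁺` by `ρ⁻` up to a vanishing budget forces `ρ⁺(ℝ) ≤ ρ⁻(ℝ)`; in particular a finite deleted mass
bounds the added mass. [folklore] -/
theorem measure_univ_le_of_window_domination {ρp ρm : Measure ℝ} {ε : ℕ → ℝ≥0∞}
    (hε : Tendsto ε atTop (𝓝 0))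
    (h : ∀ n : ℕ, windowMass ρp (δseq n) ≤ windowMass ρm (δseq n) + ε n) :
    ρp univ ≤ ρm univ :=
  measure_univ_le_of_windowMass_le hε fun n =>
    (h n).trans (add_le_add (windowMass_le_univ ρm _) le_rfl)

/-- Finite-mass corollary: under window domination, `ρ⁻` finite ⇒ `ρ⁺` finite. [folklore] -/
theorem isFiniteMeasure_of_window_domination {ρp ρm : Measure ℝ} {ε : ℕ → ℝ≥0∞}
    [IsFiniteMeasure ρm] (hε : Tendsto ε atTop (𝓝 0))
    (h : ∀ n : ℕ, windowMass ρp (δseq n) ≤ windowMass ρm (δseq n) + ε n) :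
    IsFiniteMeasure ρp :=
  ⟨lt_of_le_of_lt (measure_univ_le_of_window_domination hε h) (measure_lt_top ρm univ)⟩

/-! ## §2b The zeros'-side budget: a spectral gap makes Gaussian pairings exponentially small

With `κ = 1/δ ≥ 1` the spectral Gaussian `e^{-t²/(2δ²)}` is `gaussWindow κ t`; if a measure `μ` (the
zeros' side: `μ_Z = Σ_γ δ_γ` under RH, or any majorant of `|Σ_ρ|` symmetrised to the line) has NO MASS on
`(-γ, γ)` then its Gaussian pairing is at most `e^{-κ²γ²/4}` times a fixed pairing — the budget `η̃(δ)` of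
LEMMA GW decays like `e^{-γ₁²/(4δ²)}`, `γ₁ = 14.13…`. -/

/-- Pointwise Gaussian tail estimate: for `κ ≥ 1` and `|t| ≥ γ ≥ 0`,
`e^{-κ²t²/2} ≤ e^{-κ²γ²/4} · e^{-t²/4}`. [folklore] -/
theorem gauss_tail_pointwise {κ γ t : ℝ} (hκ : 1 ≤ κ) (hγ : 0 ≤ γ) (ht : γ ≤ |t|) :
    Real.exp (-(κ ^ 2 * t ^ 2) / 2) ≤ Real.exp (-(κ ^ 2 * γ ^ 2) / 4) * Real.exp (-(t ^ 2) / 4) := by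
  rw [← Real.exp_add]
  apply Real.exp_le_exp.2
  have h1 : γ ^ 2 ≤ t ^ 2 := by
    calc γ ^ 2 ≤ |t| ^ 2 := by gcongr
      _ = t ^ 2 := sq_abs t
  have hκ2 : 1 ≤ κ ^ 2 := by nlinarith
  have h2 : t ^ 2 ≤ κ ^ 2 * t ^ 2 := le_mul_of_one_le_left (sq_nonneg t) hκ2
  have h3 : κ ^ 2 * γ ^ 2 ≤ κ ^ 2 * t ^ 2 := mul_le_mul_of_nonneg_left h1 (by positivity)
  linarith

/-- **SPECTRAL-GAP BUDGET.**  If `μ` has no mass on `(-γ, γ)`, then for every `κ ≥ 1`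
`∫ e^{-κ²t²/2} dμ ≤ e^{-κ²γ²/4} · ∫ e^{-t²/4} dμ`. [folklore] -/
theorem windowMass_le_of_gap {μ : Measure ℝ} {γ κ : ℝ} (hγ : 0 ≤ γ) (hκ : 1 ≤ κ)
    (hgap : μ (Ioo (-γ) γ) = 0) :
    windowMass μ κ ≤
      ENNReal.ofReal (Real.exp (-(κ ^ 2 * γ ^ 2) / 4)) *
        ∫⁻ t, ENNReal.ofReal (Real.exp (-(t ^ 2) / 4)) ∂μ := by
  unfold windowMass
  rw [← lintegral_const_mul _
    ((by fun_prop : Measurable fun t : ℝ => Real.exp (-(t ^ 2) / 4)).ennreal_ofReal)]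
  apply lintegral_mono_ae
  have hae : ∀ᵐ t ∂μ, t ∉ Ioo (-γ) γ := measure_eq_zero_iff_ae_notMem.1 hgap
  filter_upwards [hae] with t ht
  have habs : γ ≤ |t| := by
    simp only [mem_Ioo, not_and_or, not_lt] at ht
    rcases ht with h | h
    · exact le_abs.2 (Or.inr (by linarith))
    · exact le_abs.2 (Or.inl h)
  unfold gaussWindow
  rw [← ENNReal.ofReal_mul (Real.exp_nonneg _)]
  exact ENNReal.ofReal_le_ofReal (gauss_tail_pointwise hκ hγ habs)

/-! ## §3 Typed g-prime-level statements (statement only) and trivial links -/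

/-- A g-prime system `(g, m)` is LOCALLY FINITE: finitely many used slots with `g i ≤ X`, for every `X`.
[folklore] -/
def LocallyFiniteSystem (g : ℕ → ℝ) (m : ℕ → ℕ) : Prop :=
  ∀ X : ℝ, {i : ℕ | g i ≤ X ∧ m i ≠ 0}.Finite

/-- `(g, m)` CONTAINS THE PRIMES: every rational prime occurs as a g-prime with multiplicity `≥ 1`
(so the perturbation `m_P − m_ℙ` is a non-negative measure: a SUPERSET system). [folklore] -/
def ContainsPrimes (g : ℕ → ℝ) (m : ℕ → ℕ) : Prop :=
  ∀ p : ℕ, p.Prime → ∃ i, g i = p ∧ 1 ≤ m i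

/-- The set of rational primes MISSING from `(g, m)`. [folklore] -/
def missingPrimes (g : ℕ → ℝ) (m : ℕ → ℕ) : Set ℕ :=
  {p : ℕ | p.Prime ∧ ¬ ∃ i, g i = p ∧ 1 ≤ m i}

/-- THEOREM F1-SUP⁺ = SUPERSET RIGIDITY (FAKES §1.16.2; THEOREM-informal, UNCONDITIONAL — inputs: the
explicit formula on truncated Gaussians, Paley–Wiener domination, 'no zero of ζ with |Im ρ| ≤ 1/2', and the
PROVED core `measure_eq_zero_of_windowMass_le`): a locally finite ζ-dressed g-prime system containing every
prime that is Weil-positive at all windows is prime-identical. (A `Prop`: statement only; not a Literature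
fact.) -/
def SupersetRigidity : Prop :=
  ∀ (g : ℕ → ℝ) (m : ℕ → ℕ), (∀ i, 1 < g i) → Function.Injective g → LocallyFiniteSystem g m →
    ContainsPrimes g m → (beurlingDatum g m).Positivity → PrimeIdentical g m

/-- THEOREM F1-SUP = FINITE-DELETION RIGIDITY, integer form (FAKES §1.16.5; THEOREM-informal, UNCONDITIONAL
by cases RH / ¬RH — ¬RH: the two-bump Landau argument of FAKES §1.1 with a non-negative bump; RH: LEMMA GW +
the PROVED core `measure_univ_le_of_window_domination` + THEOREM F1-A′): a locally finite ζ-dressed g-prime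
system missing only FINITELY MANY primes that is Weil-positive at all windows is prime-identical. (A `Prop`:
statement only; not a Literature fact.) -/
def FiniteDeletionRigidity : Prop :=
  ∀ (g : ℕ → ℝ) (m : ℕ → ℕ), (∀ i, 1 < g i) → Function.Injective g → LocallyFiniteSystem g m →
    (missingPrimes g m).Finite → (beurlingDatum g m).Positivity → PrimeIdentical g m

/-- THEOREM F1-DEL = THINNING RIGIDITY (FAKES §1.16.4; THEOREM-informal, UNCONDITIONAL — inputs:
Bochner–Schwartz, the explicit formula on Gaussians, the tables' fact 'no zero of ζ with 0 < |Im ρ| < 14',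
an explicit N(T) bound; mechanism: the Gaussian MONOTONE LAW `δ ↦ μ_P(e^{-t²/2δ²})` nondecreasing is
violated between `δ = 1/log p₀` and `2/log p₀`, `p₀` the least deleted prime): the primes with a non-empty
set of primes removed (`g i` = the `i`-th prime, multiplicities in `{0,1}`, some `0`), dressed as ζ, are
NOT Weil-positive at all windows. (A `Prop`: statement only; not a Literature fact.) -/
def ThinningRigidity : Prop :=
  ∀ m : ℕ → ℕ, (∀ i, m i ≤ 1) → (∃ i, m i = 0) →
    ¬ (beurlingDatum (fun i => (Nat.nth Nat.Prime i : ℝ)) m).Positivity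

/-- A system containing the primes misses none. [folklore] -/
theorem missingPrimes_eq_empty_of_containsPrimes {g : ℕ → ℝ} {m : ℕ → ℕ} (h : ContainsPrimes g m) :
    missingPrimes g m = ∅ := by
  ext p
  simp only [missingPrimes, mem_setOf_eq, mem_empty_iff_false, iff_false, not_and, not_not]
  exact fun hp => h p hp

/-- Finite-deletion rigidity contains superset rigidity. [folklore] -/
theorem supersetRigidity_of_finiteDeletionRigidity (h : FiniteDeletionRigidity) : SupersetRigidity := by
  intro g m hg hinj hfin hP hpos
  refine h g m hg hinj hfin ?_ hpos
  rw [missingPrimes_eq_empty_of_containsPrimes hP]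
  exact finite_empty

/-- `BeurlingRigidity` (GAP F1-G-b, OPEN) contains finite-deletion rigidity. [folklore] -/
theorem finiteDeletionRigidity_of_beurlingRigidity (h : BeurlingRigidity) : FiniteDeletionRigidity := by
  intro g m hg hinj _ _ hpos
  by_contra hne
  exact h g m hg hinj hne hpos

/-- `BeurlingRigidity` contains superset rigidity. [folklore] -/
theorem supersetRigidity_of_beurlingRigidity (h : BeurlingRigidity) : SupersetRigidity :=
  supersetRigidity_of_finiteDeletionRigidity (finiteDeletionRigidity_of_beurlingRigidity h)

end Summit.RiemannHypothesis.RiemannHypothesis.Theorems.PfPersistence.Fake1.SupersetRigidity
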